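import Summits.Ventures.GridStability.Models.StructurePreservingDAEConservation
import HarnessLib

/-!
# GridStability/Models/StructurePreservingDAEHessian — the SECOND VARIATION of the structure-preserving
# energy (Padiyar (3.32)) on the DAE record MV-4: potential part, first and second derivative along a
# line in state space, and the uniform-rotation zero mode

LADDER-GRIDFUSION G3 (model register), seat gridfusion-model-2 (g9); `plan/MODEL-VALIDITY.md` row
**MV-4** (c). Continues `StructurePreservingDAEEnergy.lean` / `…Conservation.lean` (model-2 g8: the
energy `Params.energy` = [cite: Padiyar2013, §3.4.4 eq (3.32)] / [cite: SauerPai1998, §9.8 eqs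
(9.73)–(9.77)] on the tree's DAE record [cite: SauerPai1998, §7.9.2 eqs (7.191)–(7.196)], its gradient
form (3.33)–(3.37), conservation (3.40), and «rest states = critical points»). What those files do NOT
say is whether the operating point is a MINIMUM of `W` — the second half of every region / stability
sentence on MV-4 (MODEL-VALIDITY MV-4 (c): «reading it as an ROA statement needs (i) solvability …
(ii) a DAE version of the soundness lemma»; [cite: SauerPai1998, §9.8] reads the «high- and low-power
flow solutions» as energy stationary points of different type). This file supplies the calculus:

* `potential` — `W` minus its kinetic term (`energy = kinetic + potential`, `energy_eq_kinetic_add_potential`);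
* `potentialRate` — the raw first variation of `potential` along a direction `(a, u, φ)` (the
  left-hand side of `energyRate_eq_gradientForm` with `α = 0`), `= gradientForm` (`potentialRate_eq_gradientForm`);
* `hasDerivAt_potential_line` — along the LINE `σ ↦ (δ + σa, V + σu, θ + σφ)` the potential has
  derivative `potentialRate` (from g8's `hasDerivAt_energy_path`);
* `hessianQuad` — the **second variation** (an explicit quadratic form in `(a, u, φ)`: machine
  reactance terms, network terms, and the reactive-load term `−Σ u_k² (Q′_L V − Q_L)/V²`), and
  `hasDerivAt_potentialRate_line` — along the line, `potentialRate` has derivative `hessianQuad`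
  (so `σ ↦ W(x + σd)` has second derivative `hessianQuad (x + σd) d`);
* the ZERO MODE: `potential_rotate` — with constant active loads and `Σ T_M + Σ P_L = 0` (true at every
  operating point of the lossless model, `sum_TM_add_sum_PL_eq_zero_of_isOperatingPoint`) the
  potential is invariant under the uniform rotation `(δ, θ) ↦ (δ + c, θ + c)`, and
  `hessianQuad_rotation` — the second variation vanishes on that direction. Hence NO strict minimum in
  the synchronous frame: the companion `StructurePreservingDAELocalMin.lean` works on the slice where
  one bus angle is pinned.
THREE COLUMNS: mathematics about MODEL MV-4 (MODELLED column); no certificate, no instance, no sentence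
about a grid. [cite: Padiyar2013, §3.4.4 eqs (3.32)–(3.41)]
-/

noncomputable section

open Finset Real Set MeasureTheory intervalIntegral

namespace Summit.Ventures.GridStability.Models.StructurePreservingDAE.Params

variable {m n : ℕ}

/-! ### The potential part of the energy and its first variation -/

/-- The POTENTIAL part of the structure-preserving energy (3.32): `W − W₁ =
−Σ T_Mi δᵢ + W₂₄ + W₂₅ − Σ_k P_Lk(V_k) θ_k − Σ_k ∫_{V*_k}^{V_k} Q_Lk(v)/v dv` (injected convention,
synchronous frame). [cite: Padiyar2013, §3.4.4 eq (3.32)] -/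
def potential (p : Params m n) (Vs : Fin n → ℝ) (δ : Fin m → ℝ) (V θ : Fin n → ℝ) : ℝ :=
  -∑ i, p.TM i * δ i + p.machineEnergy δ V θ + p.networkEnergy V θ
    - ∑ k, p.PL k (V k) * θ k - ∑ k, ∫ v in Vs k..V k, p.QL k v / v

/-- `W = W₁ + (W − W₁)`: the energy is the kinetic term plus the potential.
[cite: Padiyar2013, §3.4.4 eq (3.32)] -/
theorem energy_eq_kinetic_add_potential (p : Params m n) (Vs : Fin n → ℝ) (δ ω : Fin m → ℝ)
    (V θ : Fin n → ℝ) : p.energy Vs δ ω V θ = p.kinetic ω + p.potential Vs δ V θ := by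
  simp only [energy, potential]
  ring

/-- The RAW FIRST VARIATION of the potential at the state `(δ, V, θ)` along the direction
`(a, u, φ)` (term-by-term derivative of (3.32): input, machine reactances, network, constant-P loads,
reactive loads) — the left-hand side of `energyRate_eq_gradientForm` without its kinetic term.
[cite: Padiyar2013, §3.4.4 eqs (3.33)–(3.37)] -/
def potentialRate (p : Params m n) (δ a : Fin m → ℝ) (V θ u φ : Fin n → ℝ) : ℝ :=
  -∑ i, p.TM i * a i
  + ∑ i, (2 * V (p.bus i) * u (p.bus i)
      - 2 * p.E i * (u (p.bus i) * Real.cos (δ i - θ (p.bus i))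
        + V (p.bus i) * (-Real.sin (δ i - θ (p.bus i)) * (a i - φ (p.bus i))))) / (2 * p.Xd' i)
  + -(1 / 2) * ∑ k, ∑ l, p.B k l * ((u k * V l + V k * u l) * Real.cos (θ k - θ l)
      + V k * V l * (-Real.sin (θ k - θ l) * (φ k - φ l)))
  - ∑ k, p.PL k (V k) * φ k - ∑ k, p.QL k (V k) / V k * u k

/-- The raw first variation IS the printed gradient form (3.33)–(3.37) (with zero speed component):
`potentialRate = gradientForm δ ω a 0 V θ u φ` for symmetric `B` and `V_k ≠ 0` (any `ω`).
[cite: Padiyar2013, §3.4.4 eqs (3.33)–(3.37)] -/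
theorem potentialRate_eq_gradientForm {p : Params m n} (hB : ∀ k l, p.B k l = p.B l k)
    {δ a : Fin m → ℝ} (ω : Fin m → ℝ) {V θ u φ : Fin n → ℝ} (hV : ∀ k, V k ≠ 0) :
    p.potentialRate δ a V θ u φ = p.gradientForm δ ω a 0 V θ u φ := by
  have h := energyRate_eq_gradientForm hB (δ := δ) (ω := ω) (a := a) (α := 0) (V := V) (θ := θ)
    (u := u) (φ := φ) hV
  have h0 : ∑ i, p.M i * (ω i - p.ωs) * (0 : Fin m → ℝ) i = 0 := by simp
  rw [h0] at h
  unfold potentialRate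
  linarith

/-- At an operating point the first variation of the potential vanishes in every direction
(operating points are critical points, (3.33)–(3.37) all zero). [cite: Padiyar2013, §3.4.4 eqs (3.33)–(3.37)] -/
theorem potentialRate_eq_zero_of_isOperatingPoint {p : Params m n} (hB : ∀ k l, p.B k l = p.B l k)
    {δs : Fin m → ℝ} {Vs θs : Fin n → ℝ} (h : p.IsOperatingPoint δs Vs θs) (hV : ∀ k, Vs k ≠ 0)
    (a : Fin m → ℝ) (u φ : Fin n → ℝ) : p.potentialRate δs a Vs θs u φ = 0 := by
  rw [potentialRate_eq_gradientForm hB (fun _ => p.ωs) hV]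
  exact gradientForm_eq_zero_of_isOperatingPoint h a 0 u φ

/-- **First derivative of the potential along a line in state space**: for the line
`σ ↦ (δ + σa, V + σu, θ + σφ)` through a state with `V_k + s u_k > 0`, reference voltages `V*_k > 0`,
constant active loads and reactive characteristics continuous on `(0, ∞)`, the potential has
derivative `potentialRate` (evaluated on the line) at `σ = s`. [cite: Padiyar2013, §3.4.4 eqs (3.33)–(3.37)] -/
theorem hasDerivAt_potential_line {p : Params m n} (hB : ∀ k l, p.B k l = p.B l k)
    {δ a : Fin m → ℝ} {V θ u φ Vs : Fin n → ℝ} {s : ℝ} (hVpos : ∀ k, 0 < V k + s * u k)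
    (hVs : ∀ k, 0 < Vs k) (hPL : ∀ k v, p.PL k v = p.PL k (Vs k))
    (hQL : ∀ k, ContinuousOn (p.QL k) (Ioi 0)) :
    HasDerivAt (fun σ => p.potential Vs (fun i => δ i + σ * a i) (fun k => V k + σ * u k)
        (fun k => θ k + σ * φ k))
      (p.potentialRate (fun i => δ i + s * a i) a (fun k => V k + s * u k)
        (fun k => θ k + s * φ k) u φ) s := by
  have hlin : ∀ c v : ℝ, HasDerivAt (fun σ : ℝ => c + σ * v) v s := fun c v => by
    simpa using ((hasDerivAt_id s).mul_const v).const_add c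
  have hE := hasDerivAt_energy_path (p := p) hB (δ := fun σ i => δ i + σ * a i)
    (ω := fun _ _ => p.ωs) (V := fun σ k => V k + σ * u k) (θ := fun σ k => θ k + σ * φ k)
    (t := s) (a := a) (α := 0) (u := u) (φ := φ) (fun i => hlin (δ i) (a i))
    (fun _ => by simpa using hasDerivAt_const s p.ωs) (fun k => hlin (V k) (u k))
    (fun k => hlin (θ k) (φ k)) hVpos hVs hPL hQL
  have hK : HasDerivAt (fun σ => p.energy Vs (fun i => δ i + σ * a i) (fun _ => p.ωs)
      (fun k => V k + σ * u k) (fun k => θ k + σ * φ k) - p.kinetic (fun _ => p.ωs))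
      (p.gradientForm (fun i => δ i + s * a i) (fun _ => p.ωs) a 0 (fun k => V k + s * u k)
        (fun k => θ k + s * φ k) u φ) s := hE.sub_const (p.kinetic fun _ => p.ωs)
  have hfun : (fun σ => p.energy Vs (fun i => δ i + σ * a i) (fun _ => p.ωs)
      (fun k => V k + σ * u k) (fun k => θ k + σ * φ k) - p.kinetic (fun _ => p.ωs))
      = fun σ => p.potential Vs (fun i => δ i + σ * a i) (fun k => V k + σ * u k)
        (fun k => θ k + σ * φ k) := by
    funext σ
    rw [energy_eq_kinetic_add_potential]
    ring
  rw [hfun, ← potentialRate_eq_gradientForm hB (fun _ => p.ωs) (fun k => (hVpos k).ne')] at hK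
  exact hK

/-! ### The second variation -/

/-- **The second variation of the structure-preserving energy** at the state `(δ, V, θ)` along the
direction `(a, u, φ)` (a quadratic form in the direction; `Q′_L` = the derivative of the reactive
characteristic): machine reactance terms `Σᵢ (u_b² + Eᵢ(2u_b wᵢ sin(δᵢ−θ_b) + V_b wᵢ² cos(δᵢ−θ_b)))/X′_dᵢ`
with `wᵢ = aᵢ − φ_b`, network terms `−½ΣΣB_kl(2u_ku_l cos θ_kl − 2(u_kV_l+V_ku_l)φ_kl sin θ_kl − V_kV_lφ_kl² cos θ_kl)`,
reactive loads `−Σ u_k²(Q′_Lk(V_k)V_k − Q_Lk(V_k))/V_k²` — the derivative of (3.33)–(3.37) along the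
direction. [cite: Padiyar2013, §3.4.4 eqs (3.33)–(3.37)] -/
def hessianQuad (p : Params m n) (QL' : Fin n → ℝ → ℝ) (δ a : Fin m → ℝ) (V θ u φ : Fin n → ℝ) : ℝ :=
  ∑ i, (2 * u (p.bus i) ^ 2
      + 2 * p.E i * (2 * u (p.bus i) * (a i - φ (p.bus i)) * Real.sin (δ i - θ (p.bus i))
        + V (p.bus i) * (a i - φ (p.bus i)) ^ 2 * Real.cos (δ i - θ (p.bus i)))) / (2 * p.Xd' i)
  + -(1 / 2) * ∑ k, ∑ l, p.B k l * (2 * u k * u l * Real.cos (θ k - θ l)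
      - 2 * (u k * V l + V k * u l) * (φ k - φ l) * Real.sin (θ k - θ l)
      - V k * V l * (φ k - φ l) ^ 2 * Real.cos (θ k - θ l))
  - ∑ k, (QL' k (V k) * V k - p.QL k (V k)) / V k ^ 2 * u k ^ 2

/-- **Second derivative of the potential along a line** (`σ ↦ W(x + σd)` has second derivative
`hessianQuad (x + σd) d`): at a parameter `s` with `V_k + s u_k > 0`, constant active loads and reactive
characteristics differentiable at `V_k + s u_k` with derivative `Q′_Lk`, the function
`σ ↦ potentialRate (x + σd) d` has derivative `hessianQuad (x + sd) d` at `σ = s`.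
[cite: Padiyar2013, §3.4.4 eqs (3.33)–(3.37)] -/
theorem hasDerivAt_potentialRate_line {p : Params m n} {QL' : Fin n → ℝ → ℝ}
    {δ a : Fin m → ℝ} {V θ u φ Vs : Fin n → ℝ} {s : ℝ} (hVpos : ∀ k, 0 < V k + s * u k)
    (hPL : ∀ k v, p.PL k v = p.PL k (Vs k))
    (hQL : ∀ k, HasDerivAt (p.QL k) (QL' k (V k + s * u k)) (V k + s * u k)) :
    HasDerivAt (fun σ => p.potentialRate (fun i => δ i + σ * a i) a (fun k => V k + σ * u k)
        (fun k => θ k + σ * φ k) u φ)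
      (p.hessianQuad QL' (fun i => δ i + s * a i) a (fun k => V k + s * u k)
        (fun k => θ k + s * φ k) u φ) s := by
  have hlin : ∀ c v : ℝ, HasDerivAt (fun σ : ℝ => c + σ * v) v s := fun c v => by
    simpa using ((hasDerivAt_id s).mul_const v).const_add c
  -- input term: constant
  have hT : HasDerivAt (fun _ : ℝ => -∑ i, p.TM i * a i) 0 s := hasDerivAt_const _ _
  -- machine terms
  have hM : HasDerivAt (fun σ => ∑ i, (2 * (V (p.bus i) + σ * u (p.bus i)) * u (p.bus i)
      - 2 * p.E i * (u (p.bus i) * Real.cos (δ i + σ * a i - (θ (p.bus i) + σ * φ (p.bus i)))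
        + (V (p.bus i) + σ * u (p.bus i))
          * (-Real.sin (δ i + σ * a i - (θ (p.bus i) + σ * φ (p.bus i))) * (a i - φ (p.bus i)))))
      / (2 * p.Xd' i))
      (∑ i, (2 * u (p.bus i) ^ 2 + 2 * p.E i * (2 * u (p.bus i) * (a i - φ (p.bus i))
        * Real.sin (δ i + s * a i - (θ (p.bus i) + s * φ (p.bus i)))
        + (V (p.bus i) + s * u (p.bus i)) * (a i - φ (p.bus i)) ^ 2
          * Real.cos (δ i + s * a i - (θ (p.bus i) + s * φ (p.bus i))))) / (2 * p.Xd' i)) s := by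
    refine HasDerivAt.fun_sum fun i _ => ?_
    have hc := ((hlin (δ i) (a i)).fun_sub (hlin (θ (p.bus i)) (φ (p.bus i)))).cos
    have hs := ((hlin (δ i) (a i)).fun_sub (hlin (θ (p.bus i)) (φ (p.bus i)))).sin
    have h1 := ((hlin (V (p.bus i)) (u (p.bus i))).const_mul 2).mul_const (u (p.bus i))
    have h2 := hc.const_mul (u (p.bus i))
    have h3 := (hlin (V (p.bus i)) (u (p.bus i))).fun_mul (hs.fun_neg.mul_const (a i - φ (p.bus i)))
    have h4 := ((h2.fun_add h3).const_mul (2 * p.E i))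
    have h5 := (h1.fun_sub h4).div_const (2 * p.Xd' i)
    refine h5.congr_deriv ?_
    ring
  -- network terms
  have hN : HasDerivAt (fun σ => -(1 / 2) * ∑ k, ∑ l, p.B k l
      * ((u k * (V l + σ * u l) + (V k + σ * u k) * u l)
          * Real.cos (θ k + σ * φ k - (θ l + σ * φ l))
        + (V k + σ * u k) * (V l + σ * u l)
          * (-Real.sin (θ k + σ * φ k - (θ l + σ * φ l)) * (φ k - φ l))))
      (-(1 / 2) * ∑ k, ∑ l, p.B k l * (2 * u k * u l * Real.cos (θ k + s * φ k - (θ l + s * φ l))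
        - 2 * (u k * (V l + s * u l) + (V k + s * u k) * u l) * (φ k - φ l)
          * Real.sin (θ k + s * φ k - (θ l + s * φ l))
        - (V k + s * u k) * (V l + s * u l) * (φ k - φ l) ^ 2
          * Real.cos (θ k + s * φ k - (θ l + s * φ l)))) s := by
    refine HasDerivAt.const_mul (-(1 / 2) : ℝ) (HasDerivAt.fun_sum fun k _ => ?_)
    refine HasDerivAt.fun_sum fun l _ => ?_
    have hc := ((hlin (θ k) (φ k)).fun_sub (hlin (θ l) (φ l))).cos
    have hs := ((hlin (θ k) (φ k)).fun_sub (hlin (θ l) (φ l))).sin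
    have h1 := ((hlin (V l) (u l)).const_mul (u k)).fun_add ((hlin (V k) (u k)).mul_const (u l))
    have h2 := h1.fun_mul hc
    have h3 := ((hlin (V k) (u k)).fun_mul (hlin (V l) (u l))).fun_mul
      (hs.fun_neg.mul_const (φ k - φ l))
    have h4 := (h2.fun_add h3).const_mul (p.B k l)
    refine h4.congr_deriv ?_
    ring
  -- constant-P loads: the term does not depend on σ
  have hP : HasDerivAt (fun σ => ∑ k, p.PL k (V k + σ * u k) * φ k) 0 s := by
    have hconst : (fun σ => ∑ k, p.PL k (V k + σ * u k) * φ k) = fun _ => ∑ k, p.PL k (Vs k) * φ k := by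
      funext σ
      exact Finset.sum_congr rfl fun k _ => by rw [hPL k]
    exact hconst ▸ hasDerivAt_const s _
  -- reactive loads: quotient rule
  have hQ : HasDerivAt (fun σ => ∑ k, p.QL k (V k + σ * u k) / (V k + σ * u k) * u k)
      (∑ k, (QL' k (V k + s * u k) * (V k + s * u k) - p.QL k (V k + s * u k))
        / (V k + s * u k) ^ 2 * u k ^ 2) s := by
    refine HasDerivAt.fun_sum fun k _ => ?_
    have hcomp : HasDerivAt (fun σ => p.QL k (V k + σ * u k)) (QL' k (V k + s * u k) * u k) s :=
      (hQL k).comp s (hlin (V k) (u k))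
    have hdiv := (hcomp.fun_div (hlin (V k) (u k)) (hVpos k).ne').mul_const (u k)
    refine hdiv.congr_deriv ?_
    ring
  have hW := (((hT.fun_add hM).fun_add hN).fun_sub hP).fun_sub hQ
  refine (hW.congr_of_eventuallyEq ?_).congr_deriv ?_
  · exact Filter.Eventually.of_forall fun σ => by simp only [potentialRate]
  · simp only [hessianQuad]
    ring

/-! ### The uniform-rotation zero mode -/

/-- **Rotation invariance of the potential**: with CONSTANT active loads and the power balance
`Σᵢ T_Mi + Σ_k P_Lk = 0` (injected convention), `W − W₁` is unchanged when every machine angle and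
every bus angle is advanced by the same `c` (only angle DIFFERENCES enter `W₂₄`, `W₂₅`, and the
linear terms shift by `−c(Σ T_M + Σ P_L) = 0`). [cite: Padiyar2013, §3.4.4 eq (3.32)] -/
theorem potential_rotate (p : Params m n) (Vs : Fin n → ℝ) (δ : Fin m → ℝ) (V θ : Fin n → ℝ)
    (c : ℝ) (hbal : ∑ i, p.TM i + ∑ k, p.PL k (V k) = 0) :
    p.potential Vs (fun i => δ i + c) V (fun k => θ k + c) = p.potential Vs δ V θ := by
  have hME : p.machineEnergy (fun i => δ i + c) V (fun k => θ k + c) = p.machineEnergy δ V θ := by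
    unfold machineEnergy
    refine Finset.sum_congr rfl fun i _ => ?_
    rw [show δ i + c - (θ (p.bus i) + c) = δ i - θ (p.bus i) by ring]
  have hNE : p.networkEnergy V (fun k => θ k + c) = p.networkEnergy V θ := by
    unfold networkEnergy
    congr 1
    refine Finset.sum_congr rfl fun k _ => Finset.sum_congr rfl fun l _ => ?_
    rw [show θ k + c - (θ l + c) = θ k - θ l by ring]
  have h1 : ∑ i, p.TM i * (δ i + c) = ∑ i, p.TM i * δ i + c * ∑ i, p.TM i := by
    rw [Finset.mul_sum, ← Finset.sum_add_distrib]
    exact Finset.sum_congr rfl fun i _ => by ring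
  have h2 : ∑ k, p.PL k (V k) * (θ k + c) = ∑ k, p.PL k (V k) * θ k + c * ∑ k, p.PL k (V k) := by
    rw [Finset.mul_sum, ← Finset.sum_add_distrib]
    exact Finset.sum_congr rfl fun k _ => by ring
  simp only [potential, hME, hNE, h1, h2]
  linear_combination (-c) * hbal

/-- At an operating point of the lossless model the balance `Σ T_M + Σ P_L(V*) = 0` holds
(`T_Mi = P_Gi` and `Σ P_L + Σ P_G = 0`, `sum_PL_add_sum_PG_eq_zero`). [cite: SauerPai1998, §7.9.2 eqs (7.194)–(7.195)] -/
theorem sum_TM_add_sum_PL_eq_zero_of_isOperatingPoint {p : Params m n} (hp : p.WellFormed)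
    {δs : Fin m → ℝ} {Vs θs : Fin n → ℝ} (h : p.IsOperatingPoint δs Vs θs) :
    ∑ i, p.TM i + ∑ k, p.PL k (Vs k) = 0 := by
  have hsol := isSolution_of_isOperatingPoint h
  have h0 := sum_PL_add_sum_PG_eq_zero hp hsol 0
  have hTM : ∑ i, p.TM i = ∑ i, p.PG δs Vs θs i := Finset.sum_congr rfl fun i _ => h.swing i
  linarith

/-- **Rotation invariance at an operating point** (constant active loads `P_Lk(v) = P_Lk(V*_k)`):
`W − W₁` takes the same value at `(δ + c, V, θ + c)` and `(δ, V, θ)` — the energy has a ZERO MODE and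
the operating point is never a strict minimum in the synchronous frame.
[cite: Padiyar2013, §3.4.4 eq (3.32); SauerPai1998, §9.8] -/
theorem potential_rotate_of_isOperatingPoint {p : Params m n} (hp : p.WellFormed)
    {δs : Fin m → ℝ} {Vs θs : Fin n → ℝ} (h : p.IsOperatingPoint δs Vs θs)
    (hPL : ∀ k v, p.PL k v = p.PL k (Vs k)) (Vr : Fin n → ℝ) (δ : Fin m → ℝ) (V θ : Fin n → ℝ)
    (c : ℝ) : p.potential Vr (fun i => δ i + c) V (fun k => θ k + c) = p.potential Vr δ V θ := by
  refine potential_rotate p Vr δ V θ c ?_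
  have hb := sum_TM_add_sum_PL_eq_zero_of_isOperatingPoint hp h
  have : ∑ k, p.PL k (V k) = ∑ k, p.PL k (Vs k) := Finset.sum_congr rfl fun k _ => hPL k (V k)
  linarith

/-- The second variation kills the rotation direction `(a, u, φ) = (𝟙, 0, 𝟙)`: `hessianQuad = 0` there
(every `wᵢ = aᵢ − φ_b = 0`, every `φ_k − φ_l = 0`, `u = 0`). [cite: Padiyar2013, §3.4.4 eq (3.32)] -/
theorem hessianQuad_rotation (p : Params m n) (QL' : Fin n → ℝ → ℝ) (δ : Fin m → ℝ)
    (V θ : Fin n → ℝ) : p.hessianQuad QL' δ (fun _ => 1) V θ 0 (fun _ => 1) = 0 := by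
  simp [hessianQuad]

/-- **No strict minimum in the synchronous frame** (the zero mode as a theorem; APPEND model-2 g9):
at an operating point of a well-formed record with constant active loads and at least one bus, for
every radius `r > 0` there is a DIFFERENT state within sup-distance `r` — all machine and bus angles
advanced by `r` — with the SAME value of `W − W₁`. Hence every minimum / stability sentence on MODEL
MV-4 is modulo the uniform rotation (one bus angle pinned), never in the raw synchronous frame.
[cite: Padiyar2013, §3.4.4 eq (3.32)] -/
theorem exists_ne_potential_eq_of_isOperatingPoint {p : Params m n} (hp : p.WellFormed)
    {δs : Fin m → ℝ} {Vs θs : Fin n → ℝ} (h : p.IsOperatingPoint δs Vs θs)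
    (hPL : ∀ k v, p.PL k v = p.PL k (Vs k)) (hn : 0 < n) (Vr : Fin n → ℝ) {r : ℝ} (hr : 0 < r) :
    ∃ (δ : Fin m → ℝ) (θ : Fin n → ℝ), θ ≠ θs ∧ (∀ i, |δ i - δs i| ≤ r) ∧ (∀ k, |θ k - θs k| ≤ r) ∧
      p.potential Vr δ Vs θ = p.potential Vr δs Vs θs := by
  refine ⟨fun i => δs i + r, fun k => θs k + r, ?_, fun i => ?_, fun k => ?_,
    potential_rotate_of_isOperatingPoint hp h hPL Vr δs Vs θs r⟩
  · intro hθ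
    have := congr_fun hθ ⟨0, hn⟩
    linarith
  · simp [abs_of_pos hr]
  · simp [abs_of_pos hr]

end Summit.Ventures.GridStability.Models.StructurePreservingDAE.Params

end
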